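import Literature.NumberTheory.Kottwitz1992.HermitianSymmetricSpacesHolds
import HarnessLib

/-!
# [Kottwitz1992, §4 p. 387] The case `D = ℍ` of the classification of `h : ℂ → C_ℝ` — DISCHARGED:
# `Kottwitz1992_4_class_quaternion_holds`

Kernel-lane companion of the statement carpet ★ `Literature/NumberTheory/Kottwitz1992/HermitianSymmetricSpaces.lean` (squad TK; ★
`HermitianSymmetricSpacesHolds` pays the case `D = ℝ`, ★ `HermitianSymmetricSpacesClassComplexHolds` the case `D = ℂ`): the named fact ★
`HermitianSymmetricSpaces.Kottwitz1992_4_class_quaternion` — «If `D = ℍ`, then `ℂ ⊗_ℝ D` is isomorphic to `M₂(ℂ)`, and up to inner automorphisms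
of `(C, ι)`, there exists a unique `*`-homomorphism `h : ℂ → C`», typed as: `ℝ`-algebra maps `ℂ → M_n(ℍ)` exist for every `n` and any two are
conjugate under `GL_n(ℍ)` — is PROVED here.  THEOREMS ONLY (no definition, no named fact, no `sorry`, no instance, no notation); cell
hodgecm-mathlib, seat B-typ02 (g31); net debt −1.

R. E. Kottwitz, *Points on some Shimura varieties over finite fields*, J. Amer. Math. Soc. 5 (1992), §4 p. 386 L39 – p. 387 L3 (held
`paper:doi-10-2307-2152772`, p0014 L39–L48, p0015 L1–L3).  THE PRINTED ARGUMENT: «classifying `ℝ`-algebra homomorphisms `ℂ → C` up to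
conjugacy by `C^×` […] is the same as classifying isomorphism classes of `ℂ ⊗_ℝ D`-modules that are of rank `n` as `D`-modules […] If `D = ℍ`,
then `ℂ ⊗_ℝ D` is isomorphic to `M₂(ℂ)`», which has exactly one module of each admissible dimension.  In matrices (this file, no tensor
products): an `ℝ`-algebra map `h : ℂ → M_n(ℍ)` is `h(z) = re z · 1 + im z · J` with `J = h(i)`, `J² = −1` (★ `algHom_complex_apply`); `J` acts
`ℍ`-linearly on the row space `ℍⁿ` — a left `ℍ`-vector space — by `v ↦ v J`, and the `ℂ ⊗_ℝ ℍ`-module `(ℍⁿ, J)` is generated over `ℍ` by the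
`i`-eigenset `V₊ = {v | v J = i v}`: `v = ½ (v − i·vJ) + ½ (v + i·vJ)` with `v − i·vJ ∈ V₊` and `j · (v + i·vJ) ∈ V₊` (§1).  Hence `ℍⁿ` has
an `ℍ`-basis inside `V₊` (Mathlib `exists_linearIndependent` over the division ring `ℍ`), whose change-of-basis matrix `g` is a unit of
`M_n(ℍ)` (`mul_eq_one_comm`: a division ring is stably finite) with `g J = diag(i, …, i) g` (§2) — the module `(ℍⁿ, J)` is the unique one,
`(ℍ, i)ⁿ`.  So any two `h, h′` are conjugate under `GL_n(ℍ)`, and `z ↦ diag(z, …, z)` (`ℂ ⊂ ℍ`) exists for every `n` (§3).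
HONEST LABEL: HC_CM is proved only modulo the 7 printed citations (2 remaining: hLiu418, h413) until rung 0 closes; this file adds no citation
debt (0 facts, 0 sorry) and discharges 1 named fact of ★ `HermitianSymmetricSpaces`.

## References
* [Kottwitz1992] R. E. Kottwitz, Points on some Shimura varieties over finite fields, J. Amer. Math. Soc. 5 (1992) 373–444, §4 pp. 386–387.
-/

noncomputable section

open scoped Quaternion

namespace Literature.NumberTheory.Kottwitz1992.HermitianSymmetricSpaces

variable {n : ℕ}

/-! ## §1 The `i`-eigenset of the row action generates `ℍⁿ` -/

/-- For `J ∈ M_n(ℍ)` with `J² = −1` and quaternions `qi, qj` with `qi² = qj² = −1`, `qj qi = −qi qj`, the set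
`V₊ = {v ∈ ℍⁿ | v J = qi · v}` spans the left `ℍ`-vector space `ℍⁿ`: `v = ½ ((v − qi·vJ) + (v + qi·vJ))` with `v − qi·vJ ∈ V₊` and
`v + qi·vJ = −qj · (qj · (v + qi·vJ))`, `qj · (v + qi·vJ) ∈ V₊` (p. 387: the `ℂ ⊗_ℝ ℍ ≅ M₂(ℂ)`-module `ℍⁿ` is a sum of copies of the
unique simple module). [cite: Kottwitz1992, §4 (p. 387)] -/
private theorem span_eigenset_eq_top (qi qj : ℍ[ℝ]) (hii : qi * qi = -1) (hjj : qj * qj = -1)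
    (hij : qj * qi = -(qi * qj)) (J : Matrix (Fin n) (Fin n) ℍ[ℝ]) (hJ : J * J = -1) :
    Submodule.span ℍ[ℝ] {v : Fin n → ℍ[ℝ] | Matrix.vecMul v J = qi • v} = ⊤ := by
  rw [eq_top_iff]
  rintro v -
  set S := Submodule.span ℍ[ℝ] {v : Fin n → ℍ[ℝ] | Matrix.vecMul v J = qi • v}
  have hT2 : ∀ w : Fin n → ℍ[ℝ], Matrix.vecMul (Matrix.vecMul w J) J = -w := fun w => by
    rw [Matrix.vecMul_vecMul, hJ, Matrix.vecMul_neg, Matrix.vecMul_one]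
  have hiji : qi * (qj * qi) = qj := by
    rw [hij, mul_neg, ← mul_assoc, hii, neg_mul, one_mul, neg_neg]
  -- `v − qi·vJ ∈ V₊`
  have h1 : v - qi • Matrix.vecMul v J ∈ S := by
    refine Submodule.subset_span ?_
    show Matrix.vecMul (v - qi • Matrix.vecMul v J) J = qi • (v - qi • Matrix.vecMul v J)
    rw [Matrix.sub_vecMul, Matrix.smul_vecMul, hT2, smul_sub, smul_smul, hii, smul_neg, neg_smul, one_smul,
      sub_neg_eq_add, sub_neg_eq_add, add_comm]
  -- `qj · (v + qi·vJ) ∈ V₊`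
  have h2 : qj • (v + qi • Matrix.vecMul v J) ∈ S := by
    refine Submodule.subset_span ?_
    show Matrix.vecMul (qj • (v + qi • Matrix.vecMul v J)) J = qi • (qj • (v + qi • Matrix.vecMul v J))
    rw [Matrix.smul_vecMul, Matrix.add_vecMul, Matrix.smul_vecMul, hT2]
    simp only [smul_add, smul_neg, smul_smul, hiji]
    rw [hij, neg_smul, neg_neg, add_comm]
  -- `v + qi·vJ = −qj · (qj · (v + qi·vJ)) ∈ span V₊`
  have h3 : v + qi • Matrix.vecMul v J ∈ S := by
    have := S.smul_mem (-qj) h2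
    rwa [smul_smul, neg_mul, hjj, neg_neg, one_smul] at this
  have h4 := S.smul_of_tower_mem (2⁻¹ : ℝ) (S.add_mem h1 h3)
  rwa [sub_add_add_cancel, ← two_smul ℝ v, smul_smul, inv_mul_cancel₀ (two_ne_zero : (2 : ℝ) ≠ 0), one_smul] at h4

/-! ## §2 An `ℍ`-basis of `ℍⁿ` inside the eigenset: `g J = diag(qi, …, qi) g` for a unit `g` -/

/-- For `J ∈ M_n(ℍ)` with `J² = −1` there is `g ∈ GL_n(ℍ)` with `g J = diag(qi, …, qi) g`: the rows of `g` are an `ℍ`-basis of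
`ℍⁿ` chosen inside the `qi`-eigenset of `v ↦ v J` (p. 387: `(ℍⁿ, J) ≅ (ℍ, i)ⁿ` as `ℂ ⊗_ℝ ℍ`-modules).
[cite: Kottwitz1992, §4 (p. 387)] -/
private theorem exists_units_mul_eq_diagonal_mul (qi qj : ℍ[ℝ]) (hii : qi * qi = -1) (hjj : qj * qj = -1)
    (hij : qj * qi = -(qi * qj)) (J : Matrix (Fin n) (Fin n) ℍ[ℝ]) (hJ : J * J = -1) :
    ∃ g : (Matrix (Fin n) (Fin n) ℍ[ℝ])ˣ,
      (g : Matrix (Fin n) (Fin n) ℍ[ℝ]) * J = Matrix.diagonal (fun _ => qi) * (g : Matrix (Fin n) (Fin n) ℍ[ℝ]) := by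
  classical
  obtain ⟨b, hbV, hbspan, hbli⟩ :=
    exists_linearIndependent ℍ[ℝ] {v : Fin n → ℍ[ℝ] | Matrix.vecMul v J = qi • v}
  have htop : ⊤ ≤ Submodule.span ℍ[ℝ] (Set.range ((↑) : b → (Fin n → ℍ[ℝ]))) := by
    rw [Subtype.range_coe, hbspan, span_eigenset_eq_top qi qj hii hjj hij J hJ]
  let e₀ : Module.Basis b ℍ[ℝ] (Fin n → ℍ[ℝ]) := Module.Basis.mk hbli htop
  let e : Module.Basis (Fin n) ℍ[ℝ] (Fin n → ℍ[ℝ]) := e₀.reindex (e₀.indexEquiv (Pi.basisFun ℍ[ℝ] (Fin n)))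
  have he : ∀ k, Matrix.vecMul (e k) J = qi • e k := fun k => by
    have hk : e k ∈ b := by
      simp only [e, e₀, Module.Basis.reindex_apply, Module.Basis.mk_apply]
      exact Subtype.mem _
    exact hbV hk
  -- `G` = the basis vectors as rows, `H` = the standard vectors' coordinates in the basis `e`
  let G : Matrix (Fin n) (Fin n) ℍ[ℝ] := Matrix.of fun k l => e k l
  let H : Matrix (Fin n) (Fin n) ℍ[ℝ] := Matrix.of fun l k => e.repr (Pi.single l 1) k
  have hHG : H * G = 1 := by
    refine Matrix.ext fun l m => ?_
    have h := congr_fun (e.sum_repr (Pi.single l 1)) m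
    simp only [Finset.sum_apply, Pi.smul_apply, smul_eq_mul] at h
    rw [Matrix.mul_apply, Matrix.one_apply]
    simp only [G, H, Matrix.of_apply]
    rw [h]
    simp [Pi.single_apply, eq_comm]
  have hGH : G * H = 1 := mul_eq_one_comm.mp hHG
  refine ⟨⟨G, H, hGH, hHG⟩, Matrix.ext fun k l => ?_⟩
  dsimp only
  rw [Matrix.diagonal_mul, Matrix.mul_apply]
  have h := congr_fun (he k) l
  simp only [Matrix.vecMul, dotProduct, Pi.smul_apply, smul_eq_mul] at h
  simpa only [G, Matrix.of_apply] using h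

/-! ## §3 Conjugacy of any two `h, h′ : ℂ → M_n(ℍ)` and the discharge -/

/-- Any two `ℝ`-algebra maps `h, h′ : ℂ → M_n(ℍ)` are conjugate under `GL_n(ℍ)` (p. 387: «up to inner automorphisms of `(C, ι)`,
there exists a unique `*`-homomorphism `h : ℂ → C`»): with units `g, g′` such that `g h(i) = diag(qi,…,qi) g` and
`g′ h′(i) = diag(qi,…,qi) g′` (§2), `u := g′⁻¹ g` gives `u h(i) u⁻¹ = h′(i)`, hence `u h(z) u⁻¹ = h′(z)` because
`h(z) = re z · 1 + im z · h(i)` (★ `HermitianSymmetricSpacesHolds.algHom_complex_apply`). [cite: Kottwitz1992, §4 (p. 387)] -/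
private theorem exists_units_forall_eq_conj (qi qj : ℍ[ℝ]) (hii : qi * qi = -1) (hjj : qj * qj = -1)
    (hij : qj * qi = -(qi * qj)) (h h' : ℂ →ₐ[ℝ] Matrix (Fin n) (Fin n) ℍ[ℝ]) :
    ∃ g : (Matrix (Fin n) (Fin n) ℍ[ℝ])ˣ, ∀ z : ℂ,
      h' z = (g : Matrix (Fin n) (Fin n) ℍ[ℝ]) * h z * (g⁻¹ : (Matrix (Fin n) (Fin n) ℍ[ℝ])ˣ) := by
  have hsq : ∀ f : ℂ →ₐ[ℝ] Matrix (Fin n) (Fin n) ℍ[ℝ], f Complex.I * f Complex.I = -1 := fun f => by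
    rw [← map_mul, Complex.I_mul_I, map_neg, map_one]
  obtain ⟨g, hg⟩ := exists_units_mul_eq_diagonal_mul qi qj hii hjj hij (h Complex.I) (hsq h)
  obtain ⟨g', hg'⟩ := exists_units_mul_eq_diagonal_mul qi qj hii hjj hij (h' Complex.I) (hsq h')
  refine ⟨g'⁻¹ * g, fun z => ?_⟩
  have e1 : h Complex.I = ((g⁻¹ : (Matrix (Fin n) (Fin n) ℍ[ℝ])ˣ) : Matrix (Fin n) (Fin n) ℍ[ℝ]) *
      (Matrix.diagonal (fun _ : Fin n => qi) * (g : Matrix (Fin n) (Fin n) ℍ[ℝ])) :=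
    (Units.eq_inv_mul_iff_mul_eq (b := g)).mpr hg
  have e2 : h' Complex.I = ((g'⁻¹ : (Matrix (Fin n) (Fin n) ℍ[ℝ])ˣ) : Matrix (Fin n) (Fin n) ℍ[ℝ]) *
      (Matrix.diagonal (fun _ : Fin n => qi) * (g' : Matrix (Fin n) (Fin n) ℍ[ℝ])) :=
    (Units.eq_inv_mul_iff_mul_eq (b := g')).mpr hg'
  have hI : ((g'⁻¹ * g : (Matrix (Fin n) (Fin n) ℍ[ℝ])ˣ) : Matrix (Fin n) (Fin n) ℍ[ℝ]) * h Complex.I *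
      ((g'⁻¹ * g)⁻¹ : (Matrix (Fin n) (Fin n) ℍ[ℝ])ˣ) = h' Complex.I := by
    rw [e1, e2, mul_inv_rev, inv_inv, Units.val_mul, Units.val_mul]
    simp only [mul_assoc, Units.mul_inv_cancel_left]
  rw [HermitianSymmetricSpacesHolds.algHom_complex_apply h' z, HermitianSymmetricSpacesHolds.algHom_complex_apply h z, ← hI,
    mul_add, add_mul, Matrix.mul_smul, Matrix.smul_mul, mul_one, Units.mul_inv, Matrix.mul_smul, Matrix.smul_mul]

/-- **[Kottwitz1992, §4 p. 387, case `D = ℍ`] holds**: `ℝ`-algebra maps `ℂ → M_n(ℍ)` exist for every `n` (`z ↦ diag(z, …, z)` through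
`ℂ ⊂ ℍ`: Mathlib `Quaternion.ofComplex` and `Matrix.scalarAlgHom`) and any two are conjugate under `GL_n(ℍ)` (§3 with `qi = i = (0,1,0,0)`,
`qj = j = (0,0,1,0)`: `i² = j² = −1`, `j i = −i j`). [cite: Kottwitz1992, §4 (p. 387)] -/
theorem Kottwitz1992_4_class_quaternion_holds : Kottwitz1992_4_class_quaternion := fun n =>
  ⟨⟨(Matrix.scalarAlgHom (Fin n) ℝ).comp Quaternion.ofComplex⟩, fun h h' =>
    exists_units_forall_eq_conj ⟨0, 1, 0, 0⟩ ⟨0, 0, 1, 0⟩ (by ext <;> simp) (by ext <;> simp) (by ext <;> simp) h h'⟩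

end Literature.NumberTheory.Kottwitz1992.HermitianSymmetricSpaces

end
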